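import Summits.Ventures.PercRepro.S1FiveCircuitCountSharpB

/-!
# PercRepro — THE SHARP FIVE-CIRCUIT COUNT AT BOUNDED NULLITY, PART C: `48·s₅ ≤ 7ν(ν+1)(ν² + ν + 10)` under «rank-`4` sets
≤ 10» (p8, gen 19; a feeder for S4 — the top of the `q = 7` window, the row `65`)

* **`twelve_mul_ncard_fiveThrough_le_sharp`** — the `5`-circuits through `e` under «rank-`4` sets ≤ 10»:
  `12·#{…} ≤ 7ν³ + 35ν` (they inject into the `4`-circuits of `M ／ {e}`, whose planes have `≤ 9` points — Part B);
* **`fortyEight_mul_ncard_five_circuits_le_sharp`** — `48·s₅ ≤ 7ν(ν+1)(ν² + ν + 10)`, against LEMMA T5's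
  `7ν(ν+1)(ν+2)(ν+3)` (the last factor `1 132` against `1 260` at `ν = 33` — the cells `(65, 30 … 33)` of the level-`7` chain).
Axioms: standard.
-/

open scoped Matroid

namespace PercRepro

namespace S1

open Set

variable {α : Type}

/-- **The `5`-circuits through a point, the rank-`4` sets with `≤ 10` points, SHARP**: `12·#{5-circuits through e} ≤ 7d³ + 35d` —
they inject (`C ↦ C ∖ {e}`) into the `4`-circuits of `M ／ {e}`, whose rank-`≤ 3` sets have `≤ 9` points
(`twelve_mul_ncard_four_circuits_le_of_planes_nine`). -/
theorem twelve_mul_ncard_fiveThrough_le_sharp (M : Matroid α) [M.Finite]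
    (hflat : ∀ X ⊆ M.E, M.eRk X ≤ 4 → X.ncard ≤ 10) {e : α} (heI : M.Indep {e}) {d : ℕ}
    (hd : M.E.encard = M.eRank + d) :
    12 * {C : Set α | M.IsCircuit C ∧ C.ncard = 5 ∧ e ∈ C}.ncard ≤ 7 * d * d * d + 35 * d := by
  classical
  have heE : e ∈ M.E := heI.subset_ground (mem_singleton e)
  have hν : M✶.eRank = (d : ℕ∞) := dual_eRank_eq_of_encard M hd
  set N := M ／ {e} with hN
  have hNd : N.E.encard = N.eRank + d := by
    apply encard_eq_of_dual_eRank
    rw [hN, PercRepro.Matroid.dual_eRank_contract_singleton heI, hν]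
  have hNE : N.E = M.E \ {e} := _root_.Matroid.contract_ground M {e}
  have hN' : ∀ L ⊆ N.E, N.eRk L ≤ 3 → L.ncard ≤ 9 := by
    intro L hL hr
    rw [hNE] at hL
    have heL : e ∉ L := fun h => (hL h).2 rfl
    have hLfin : L.Finite := M.ground_finite.subset (hL.trans sdiff_subset)
    have hins : M.eRk (insert e L) ≤ 4 := by
      have h := contract_singleton_eRk_add_one heI hL
      rw [← hN] at h
      rw [← h]
      calc N.eRk L + 1 ≤ 3 + 1 := add_le_add_left hr 1
        _ = 4 := by norm_num
    have hb := hflat (insert e L) (insert_subset heE (hL.trans sdiff_subset)) hins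
    rw [ncard_insert_of_notMem heL hLfin] at hb
    omega
  set S₁ := {C : Set α | M.IsCircuit C ∧ C.ncard = 5 ∧ e ∈ C} with hS₁
  let f : Set α → Set α := fun C => C \ {e}
  have hmaps : ∀ C ∈ S₁, f C ∈ {C' : Set α | N.IsCircuit C' ∧ C'.ncard = 4} := by
    intro C hC
    have hCfin : C.Finite := M.ground_finite.subset hC.1.subset_ground
    refine ⟨hC.1.contractElem_isCircuit ?_ hC.2.2, ?_⟩
    · have h1lt : 1 < C.ncard := by rw [hC.2.1]; omega
      obtain ⟨x, hx, y, hy, hxy⟩ := (one_lt_ncard hCfin).1 h1lt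
      exact ⟨x, hx, y, hy, hxy⟩
    · have h3 := ncard_sdiff_singleton_add_one hC.2.2 hCfin
      have h4 := hC.2.1
      simp only [f]
      omega
  have hinj : InjOn f S₁ := by
    intro C hC C' hC' h
    have e1 : C = insert e (C \ {e}) := by rw [insert_sdiff_singleton, insert_eq_of_mem hC.2.2]
    have e2 : C' = insert e (C' \ {e}) := by rw [insert_sdiff_singleton, insert_eq_of_mem hC'.2.2]
    rw [e1, e2]
    simp only [f] at h
    rw [h]
  have hle : S₁.ncard ≤ {C' : Set α | N.IsCircuit C' ∧ C'.ncard = 4}.ncard :=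
    ncard_le_ncard_of_injOn f hmaps hinj
      (N.ground_finite.finite_subsets.subset (fun C hC => hC.1.subset_ground))
  have hinner := twelve_mul_ncard_four_circuits_le_of_planes_nine N hN' hNd
  calc 12 * S₁.ncard ≤ 12 * {C' : Set α | N.IsCircuit C' ∧ C'.ncard = 4}.ncard := Nat.mul_le_mul_left _ hle
    _ ≤ 7 * d * d * d + 35 * d := hinner

/-- **THE SHARP FIVE-CIRCUIT COUNT at bounded nullity, the rank-`4` sets with `≤ 10` points**:
`48·s₅ ≤ 7d(d+1)(d² + d + 10)` (against LEMMA T5's `7d(d+1)(d+2)(d+3)`: `1 132` against `1 260` in the last factor at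
`d = 33`) — the deletion induction with the sharp count through the deleted point (`twelve_mul_ncard_fiveThrough_le_sharp`):
`48·s₅ ≤ 4(7d³ + 35d) + 7(d−1)d((d−1)² + (d−1) + 10)`. -/
theorem fortyEight_mul_ncard_five_circuits_le_sharp (M : Matroid α) [M.Finite]
    (hflat : ∀ X ⊆ M.E, M.eRk X ≤ 4 → X.ncard ≤ 10) {d : ℕ} (hd : M.E.encard = M.eRank + d) :
    48 * {C : Set α | M.IsCircuit C ∧ C.ncard = 5}.ncard ≤ 7 * d * (d + 1) * (d * d + d + 10) := by
  suffices H : ∀ n : ℕ, ∀ (M : Matroid α) [M.Finite], M.E.ncard = n →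
      (∀ X ⊆ M.E, M.eRk X ≤ 4 → X.ncard ≤ 10) → ∀ d : ℕ, M.E.encard = M.eRank + d →
      48 * {C : Set α | M.IsCircuit C ∧ C.ncard = 5}.ncard ≤ 7 * d * (d + 1) * (d * d + d + 10) from H _ M rfl hflat d hd
  intro n
  induction n using Nat.strong_induction_on with
  | _ n ih =>
  intro M _ hn hflat d hd
  classical
  set S := {C : Set α | M.IsCircuit C ∧ C.ncard = 5} with hS
  have hSfin : S.Finite :=
    M.ground_finite.finite_subsets.subset (fun C hC => hC.1.subset_ground)
  by_cases hSe : S = ∅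
  · rw [hSe, ncard_empty]; exact Nat.zero_le _
  obtain ⟨C₀, hC₀⟩ := nonempty_iff_ne_empty.2 hSe
  obtain ⟨e, heC₀⟩ := hC₀.1.nonempty
  have heE : e ∈ M.E := hC₀.1.subset_ground heC₀
  have hne : ¬ M.IsColoop e := hC₀.1.not_isColoop_of_mem heC₀
  have hν : M✶.eRank = (d : ℕ∞) := dual_eRank_eq_of_encard M hd
  have hdel := PercRepro.Matroid.dual_eRank_delete_singleton_add_one heE hne
  rw [hν] at hdel
  have hfin' : (M ＼ {e})✶.eRank ≠ ⊤ := by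
    intro h
    rw [h] at hdel
    exact absurd hdel (by simp)
  obtain ⟨d', hd'⟩ := ENat.ne_top_iff_exists.1 hfin'
  have hdd' : d = d' + 1 := by
    rw [← hd'] at hdel
    exact_mod_cast hdel.symm
  have hd'enc : (M ＼ {e}).E.encard = (M ＼ {e}).eRank + d' := encard_eq_of_dual_eRank _ hd'.symm
  have hdelE : (M ＼ {e}).E.ncard < n := by
    rw [_root_.Matroid.delete_ground, ← hn, ← ncard_sdiff_singleton_add_one heE M.ground_finite]
    omega
  have hflat' : ∀ X ⊆ (M ＼ {e}).E, (M ＼ {e}).eRk X ≤ 4 → X.ncard ≤ 10 := by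
    intro X hX hr
    rw [_root_.Matroid.delete_ground] at hX
    rw [delete_singleton_eRk_eq hX] at hr
    exact hflat X (hX.trans sdiff_subset) hr
  have heI : M.Indep {e} := by
    rw [_root_.Matroid.indep_singleton, ← _root_.Matroid.not_isLoop_iff heE]
    intro hloop
    have hC₀e : C₀ = {e} := hloop.eq_of_isCircuit_mem hC₀.1 heC₀
    have := hC₀.2
    rw [hC₀e, ncard_singleton] at this
    omega
  set S₁ := {C : Set α | M.IsCircuit C ∧ C.ncard = 5 ∧ e ∈ C} with hS₁
  set S₂ := {C : Set α | M.IsCircuit C ∧ C.ncard = 5 ∧ e ∉ C} with hS₂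
  have hsplit : S ⊆ S₁ ∪ S₂ := by
    intro C hC
    by_cases h : e ∈ C
    · exact Or.inl ⟨hC.1, hC.2, h⟩
    · exact Or.inr ⟨hC.1, hC.2, h⟩
  have hS₁fin : S₁.Finite := hSfin.subset (fun C hC => ⟨hC.1, hC.2.1⟩)
  have hS₂fin : S₂.Finite := hSfin.subset (fun C hC => ⟨hC.1, hC.2.1⟩)
  have h1 : 12 * S₁.ncard ≤ 7 * d * d * d + 35 * d := twelve_mul_ncard_fiveThrough_le_sharp M hflat heI hd
  have h2c : 48 * S₂.ncard ≤ 7 * d' * (d' + 1) * (d' * d' + d' + 10) := by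
    have hsub : S₂ ⊆ {C : Set α | (M ＼ {e}).IsCircuit C ∧ C.ncard = 5} := by
      intro C hC
      exact ⟨_root_.Matroid.delete_isCircuit_iff.2 ⟨hC.1, disjoint_singleton_right.2 hC.2.2⟩, hC.2.1⟩
    calc 48 * S₂.ncard ≤ 48 * {C : Set α | (M ＼ {e}).IsCircuit C ∧ C.ncard = 5}.ncard := by
          apply Nat.mul_le_mul_left
          exact ncard_le_ncard hsub
            ((M ＼ {e}).ground_finite.finite_subsets.subset (fun C hC => hC.1.subset_ground))
      _ ≤ _ := ih _ hdelE (M ＼ {e}) rfl hflat' d' hd'enc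
  have h3 : S.ncard ≤ S₁.ncard + S₂.ncard :=
    (ncard_le_ncard hsplit (hS₁fin.union hS₂fin)).trans (ncard_union_le _ _)
  subst hdd'
  nlinarith [h1, h2c, h3]

end S1

end PercRepro
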